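import Mathlib
import Summits.NavierStokesRegularity.NavierStokesRegularity.Theses.PlaneEnergyCeiling
import Summits.NavierStokesRegularity.NavierStokesRegularity.Theorems.PlaneEnergyCeilingSlabEnergyIdentitySlab
import Summits.NavierStokesRegularity.NavierStokesRegularity.Theorems.PlaneEnergyCeilingSlabEnergyIdentityPointwise
import Summits.NavierStokesRegularity.NavierStokesRegularity.Theorems.PlaneEnergyCeilingScaledEnergyOfPlanar

/-!
# Route PlaneEnergyCeiling · crux `PlanarEnergyAPriori` — what the crux excludes: the `|x|⁻¹` scar

Helper file for the crux item stmt-NavierStokesRegularity-16855 (`PlanarEnergyAPriori`, route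
`PlaneEnergyCeiling`), landed `--supports` that item. The route's KILL CRITERIA / NUMBERS say that a
Type-I blow-up with the self-similar `|x|⁻¹` far-field scar (self-similar or discretely
self-similar profiles, `|u(x,t)| ≈ κ/(√(T−t) + |x − x₀|)`) has LOG-DIVERGENT planar energy through
the blow-up point, so the crux excludes it. This file proves that calibration:

* `integral_ball_scar_eq` — polar coordinates in `ℝ²`:
  `∫_{|z|<L} κ²/(a+|z|)² dz = 2πκ² (log((a+L)/a) − L/(a+L))`;
* `planarEnergy_ge_of_scar` — if `‖w x‖ ≥ κ/(a + ‖x − x₀‖)` on the ball `B(x₀, L)` of `ℝ³`, the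
  planar energy of `w` through `x₀` (plane `{x₂ = (x₀)₂}`) is at least that quantity;
* `tendsto_scar_lowerBound_atTop` — it tends to `+∞` as the core size `a ↓ 0`;
* `PlanarEnergyAPriori.no_scar` — hence, GIVEN the crux, no classical Leray–Hopf solution from a
  rapidly decaying datum can carry scar lower bounds `κ/(a + |x − x₀|)` on a fixed ball with
  arbitrarily small cores `a` before `T` (in particular no (discretely) self-similar Type-I blow-up
  with a non-degenerate far-field profile); registered closed form `planarEnergyAPriori_no_scar`;
* `PlanarEnergyAPriori.scaledEnergy_bound` — GIVEN the crux, every such solution has uniformly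
  bounded Caffarelli–Kohn–Nirenberg scaled energy `∫_{B_r(x₀)}|u(t)|² ≤ 2rM` (all `t < T`, `x₀`,
  `r > 0`): Seregin's Type-I-in-energy class (the strategist's D1, piece 1), through the landed
  support item `ScaledEnergyOfPlanar`.

Folklore calculus (route file NUMBERS: `E(plane through x₀) ≈ 2πc² log(L/√(ν(T−t)))`).
-/

noncomputable section

-- single-conjunct summit: `Summit.<Summit>.<Problem>` repeats the name by the D-0017 layout
set_option linter.dupNamespace false

namespace Summit.NavierStokesRegularity.NavierStokesRegularity.Theorems.PlanarEnergyAPriori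

open MeasureTheory Set Filter Topology WithLp Metric Real
open scoped ENNReal
open Summit.NavierStokesRegularity.NavierStokesRegularity.Theorems.PlaneEnergyCeilingSlabEnergyIdentity

/-! ### The radial integral -/

/-- The radial antiderivative: `d/dy (log(a+y) + a/(a+y)) = y/(a+y)²` for `a + y > 0`. -/
theorem hasDerivAt_scar_antideriv {a y : ℝ} (h : 0 < a + y) :
    HasDerivAt (fun y => Real.log (a + y) + a * (a + y)⁻¹) (y / (a + y) ^ 2) y := by
  have h1 : HasDerivAt (fun y : ℝ => a + y) 1 y := by simpa using (hasDerivAt_id y).const_add a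
  have hlog := h1.log h.ne'
  have hinv := (h1.inv h.ne').const_mul a
  have hne : a + y ≠ 0 := h.ne'
  have key : HasDerivAt (fun y => Real.log (a + y) + a * (a + y)⁻¹) (1 / (a + y) + a * (-1 / (a + y) ^ 2)) y :=
    hlog.add hinv
  refine key.congr_deriv ?_
  field_simp
  ring

/-- `∫₀ᴸ y/(a+y)² dy = log((a+L)/a) − L/(a+L)` for `0 < a`, `0 ≤ L`. -/
theorem integral_scar_radial {a L : ℝ} (ha : 0 < a) (hL : 0 ≤ L) :
    ∫ y in (0 : ℝ)..L, y / (a + y) ^ 2 = Real.log ((a + L) / a) - L / (a + L) := by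
  have hderiv : ∀ y ∈ uIcc 0 L, HasDerivAt (fun y => Real.log (a + y) + a * (a + y)⁻¹) (y / (a + y) ^ 2) y := by
    intro y hy
    rw [uIcc_of_le hL] at hy
    exact hasDerivAt_scar_antideriv (by linarith [hy.1])
  have hcont : ContinuousOn (fun y : ℝ => y / (a + y) ^ 2) (uIcc 0 L) := by
    rw [uIcc_of_le hL]
    refine continuousOn_id.div (by fun_prop) fun y hy => ?_
    exact pow_ne_zero 2 (by linarith [hy.1] : a + y ≠ 0)
  rw [intervalIntegral.integral_eq_sub_of_hasDerivAt hderiv (hcont.intervalIntegrable), Real.log_div (by linarith) ha.ne']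
  simp only [add_zero]
  field_simp
  ring

/-- **Polar coordinates for the scar profile in `ℝ²`**: for `0 < a`, `0 ≤ L`,
`∫_{|z| < L} κ²/(a + |z|)² dz = 2πκ² (log((a+L)/a) − L/(a+L))`. -/
theorem integral_ball_scar_eq {κ a L : ℝ} (ha : 0 < a) (hL : 0 ≤ L) :
    ∫ z in ball (0 : EuclideanSpace ℝ (Fin 2)) L, κ ^ 2 / (a + ‖z‖) ^ 2 =
      2 * π * κ ^ 2 * (Real.log ((a + L) / a) - L / (a + L)) := by
  set f : ℝ → ℝ := (Iio L).indicator fun r => κ ^ 2 / (a + r) ^ 2 with hf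
  have hind : ∀ z : EuclideanSpace ℝ (Fin 2),
      (ball (0 : EuclideanSpace ℝ (Fin 2)) L).indicator (fun z => κ ^ 2 / (a + ‖z‖) ^ 2) z = f ‖z‖ := by
    intro z
    by_cases hz : ‖z‖ < L
    · rw [indicator_of_mem (mem_ball_zero_iff.2 hz), hf, indicator_of_mem (mem_Iio.2 hz)]
    · rw [indicator_of_notMem (fun h' => hz (mem_ball_zero_iff.1 h')), hf,
        indicator_of_notMem (fun h' => hz (mem_Iio.1 h'))]
  have hrad : ∀ y ∈ Ioi (0 : ℝ), y ^ (Module.finrank ℝ (EuclideanSpace ℝ (Fin 2)) - 1) • f y =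
      (Ioo (0 : ℝ) L).indicator (fun y => κ ^ 2 * (y / (a + y) ^ 2)) y := by
    intro y hy
    have hy0 : (0 : ℝ) < y := hy
    rw [finrank_euclideanSpace_fin]
    simp only [hf, Set.indicator_apply, mem_Iio, mem_Ioo, hy0, true_and, smul_eq_mul]
    split_ifs with h
    · ring
    · simp
  have hreal : (volume : Measure (EuclideanSpace ℝ (Fin 2))).real (ball 0 1) = π := by
    rw [measureReal_def, EuclideanSpace.volume_ball_fin_two]
    simp [ENNReal.toReal_ofReal pi_pos.le]
  calc ∫ z in ball (0 : EuclideanSpace ℝ (Fin 2)) L, κ ^ 2 / (a + ‖z‖) ^ 2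
      = ∫ z, (ball (0 : EuclideanSpace ℝ (Fin 2)) L).indicator (fun z => κ ^ 2 / (a + ‖z‖) ^ 2) z :=
        (integral_indicator measurableSet_ball).symm
    _ = ∫ z : EuclideanSpace ℝ (Fin 2), f ‖z‖ := by simp_rw [hind]
    _ = 2 * π * κ ^ 2 * (Real.log ((a + L) / a) - L / (a + L)) := by
        rw [integral_fun_norm_addHaar volume f, setIntegral_congr_fun measurableSet_Ioi hrad,
          setIntegral_indicator measurableSet_Ioo,
          (inter_eq_right.2 Ioo_subset_Ioi_self : Ioi (0 : ℝ) ∩ Ioo 0 L = Ioo 0 L),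
          ← integral_Ioc_eq_integral_Ioo, ← intervalIntegral.integral_of_le hL,
          intervalIntegral.integral_const_mul, integral_scar_radial ha hL, hreal, finrank_euclideanSpace_fin]
        simp only [nsmul_eq_mul, smul_eq_mul]
        push_cast
        ring

/-- The scar profile `κ²/(a+‖z‖)²` is integrable on the disc `|z| < L` (it is bounded by
`κ²/a²` on a set of finite measure). -/
theorem integrableOn_ball_scar {κ a L : ℝ} (ha : 0 < a) :
    IntegrableOn (fun z : EuclideanSpace ℝ (Fin 2) => κ ^ 2 / (a + ‖z‖) ^ 2) (ball 0 L) := by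
  refine Measure.integrableOn_of_bounded (M := κ ^ 2 / a ^ 2) measure_ball_lt_top.ne ?_ ?_
  · exact (continuous_const.div (by fun_prop) fun z => pow_ne_zero 2 (by positivity)).aestronglyMeasurable
  · refine ae_of_all _ fun z => ?_
    rw [Real.norm_of_nonneg (by positivity)]
    exact div_le_div_of_nonneg_left (sq_nonneg κ) (pow_pos ha 2)
      (pow_le_pow_left₀ ha.le (by linarith [norm_nonneg z]) 2)

/-! ### Planar energy through the centre of a scar -/

/-- The in-plane distance: for the plane `{x₂ = (x₀)₂}` through `x₀`,
`‖(y₀', y₁', (x₀)₂) − x₀‖ = ‖y − ((x₀)₀, (x₀)₁)‖`. -/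
theorem norm_toLp_vec3_sub_center (y : EuclideanSpace ℝ (Fin 2)) (x₀ : EuclideanSpace ℝ (Fin 3)) :
    ‖(toLp 2 ![y 0, y 1, x₀ 2] : EuclideanSpace ℝ (Fin 3)) - x₀‖ =
      ‖y - (toLp 2 ![x₀ 0, x₀ 1] : EuclideanSpace ℝ (Fin 2))‖ := by
  have h3 : ‖(toLp 2 ![y 0, y 1, x₀ 2] : EuclideanSpace ℝ (Fin 3)) - x₀‖ ^ 2 =
      (y 0 - x₀ 0) ^ 2 + (y 1 - x₀ 1) ^ 2 := by
    rw [EuclideanSpace.real_norm_sq_eq, Fin.sum_univ_three]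
    simp
  have h2 : ‖y - (toLp 2 ![x₀ 0, x₀ 1] : EuclideanSpace ℝ (Fin 2))‖ ^ 2 = (y 0 - x₀ 0) ^ 2 + (y 1 - x₀ 1) ^ 2 := by
    rw [EuclideanSpace.real_norm_sq_eq, Fin.sum_univ_two]
    simp
  have := h3.trans h2.symm
  exact (sq_eq_sq₀ (norm_nonneg _) (norm_nonneg _)).1 this

/-- **Planar energy through the centre of a scar.** If a field `w` on `ℝ³` satisfies
the scar lower bound `‖w x‖ ≥ κ/(a + ‖x − x₀‖)` on the ball `B(x₀, L)` (`κ ≥ 0`, `a > 0`,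
`L ≥ 0`), then its planar energy through `x₀` (plane `{x₂ = (x₀)₂}`) is at least
`2πκ² (log((a+L)/a) − L/(a+L))`. -/
theorem planarEnergy_ge_of_scar {w : EuclideanSpace ℝ (Fin 3) → EuclideanSpace ℝ (Fin 3)}
    {κ a L : ℝ} (hκ : 0 ≤ κ) (ha : 0 < a) (hL : 0 ≤ L) (x₀ : EuclideanSpace ℝ (Fin 3))
    (hscar : ∀ x ∈ ball x₀ L, κ / (a + ‖x - x₀‖) ≤ ‖w x‖) :
    ENNReal.ofReal (2 * π * κ ^ 2 * (Real.log ((a + L) / a) - L / (a + L))) ≤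
      ∫⁻ y : EuclideanSpace ℝ (Fin 2), ‖w (toLp 2 ![y 0, y 1, x₀ 2])‖ₑ ^ 2 := by
  -- the centre of the scar in the plane coordinates, and the radial profile
  obtain ⟨y₀, hy₀⟩ : ∃ y₀ : EuclideanSpace ℝ (Fin 2), y₀ = toLp 2 ![x₀ 0, x₀ 1] := ⟨_, rfl⟩
  obtain ⟨g, hg⟩ : ∃ g : EuclideanSpace ℝ (Fin 2) → ℝ, g = fun z => κ ^ 2 / (a + ‖z‖) ^ 2 := ⟨_, rfl⟩
  have hgnn : ∀ z, 0 ≤ g z := fun z => by rw [hg]; positivity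
  -- the scar bound on the plane, in squared `ℝ≥0∞` form
  have hpt : ∀ y ∈ ball y₀ L,
      ENNReal.ofReal (g (y - y₀)) ≤ ‖w (toLp 2 ![y 0, y 1, x₀ 2])‖ₑ ^ 2 := by
    intro y hy
    have hdist : ‖(toLp 2 ![y 0, y 1, x₀ 2] : EuclideanSpace ℝ (Fin 3)) - x₀‖ = ‖y - y₀‖ := by
      rw [norm_toLp_vec3_sub_center, hy₀]
    have hmem : (toLp 2 ![y 0, y 1, x₀ 2] : EuclideanSpace ℝ (Fin 3)) ∈ ball x₀ L := by
      rw [mem_ball_iff_norm, hdist]; exact mem_ball_iff_norm.1 hy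
    have h1 := hscar _ hmem
    rw [hdist] at h1
    have h0 : 0 ≤ κ / (a + ‖y - y₀‖) := by positivity
    have h2 := pow_le_pow_left₀ h0 h1 2
    rw [div_pow] at h2
    rw [← ofReal_norm, ← ENNReal.ofReal_pow (norm_nonneg _), hg]
    exact ENNReal.ofReal_le_ofReal h2
  -- the indicator bookkeeping for the translation to the origin
  have hind : ∀ y, (ball y₀ L).indicator (fun y => g (y - y₀)) y =
      (ball (0 : EuclideanSpace ℝ (Fin 2)) L).indicator g (y - y₀) := by
    intro y
    by_cases hy : y ∈ ball y₀ L
    · rw [indicator_of_mem hy, indicator_of_mem (mem_ball_zero_iff.2 (mem_ball_iff_norm.1 hy))]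
    · rw [indicator_of_notMem hy,
        indicator_of_notMem (fun h' => hy (mem_ball_iff_norm.2 (mem_ball_zero_iff.1 h')))]
  have hint0 : IntegrableOn g (ball 0 L) := by rw [hg]; exact integrableOn_ball_scar ha
  have hshift : ∫ y in ball y₀ L, g (y - y₀) = ∫ z in ball (0 : EuclideanSpace ℝ (Fin 2)) L, g z := by
    rw [← integral_indicator measurableSet_ball, ← integral_indicator measurableSet_ball]
    simp_rw [hind]
    exact integral_sub_right_eq_self _ y₀
  have hintS : IntegrableOn (fun y => g (y - y₀)) (ball y₀ L) := by
    have h1 : Integrable ((ball (0 : EuclideanSpace ℝ (Fin 2)) L).indicator g) :=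
      hint0.integrable_indicator measurableSet_ball
    have h2 := h1.comp_sub_right y₀
    rw [← integrable_indicator_iff measurableSet_ball]
    refine h2.congr (ae_of_all _ fun y => ?_)
    exact (hind y).symm
  have e1 : 2 * π * κ ^ 2 * (Real.log ((a + L) / a) - L / (a + L)) =
      ∫ y in ball y₀ L, g (y - y₀) := by
    rw [hshift, hg]; exact (integral_ball_scar_eq ha hL).symm
  have e3 : ENNReal.ofReal (∫ y in ball y₀ L, g (y - y₀)) = ∫⁻ y in ball y₀ L, ENNReal.ofReal (g (y - y₀)) :=
    ofReal_integral_eq_lintegral_ofReal hintS (ae_of_all _ fun y => hgnn _)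
  have e4 : ∫⁻ y in ball y₀ L, ENNReal.ofReal (g (y - y₀)) ≤
      ∫⁻ y in ball y₀ L, ‖w (toLp 2 ![y 0, y 1, x₀ 2])‖ₑ ^ 2 := setLIntegral_mono' measurableSet_ball hpt
  rw [e1, e3]
  exact e4.trans (setLIntegral_le_lintegral _ _)

/-- The scar lower bound diverges as the core shrinks: for `κ > 0`, `L > 0` and any `M` there is
`a > 0` with `M < 2πκ² (log((a+L)/a) − L/(a+L))`. -/
theorem exists_scar_lowerBound_gt {κ L : ℝ} (hκ : 0 < κ) (hL : 0 < L) (M : ℝ) :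
    ∃ a : ℝ, 0 < a ∧ M < 2 * π * κ ^ 2 * (Real.log ((a + L) / a) - L / (a + L)) := by
  set K : ℝ := M / (2 * π * κ ^ 2) + 1 with hK
  have hc : 0 < 2 * π * κ ^ 2 := by positivity
  refine ⟨L / Real.exp K, by positivity, ?_⟩
  set a : ℝ := L / Real.exp K with ha
  have ha0 : 0 < a := by positivity
  have hlog : K < Real.log ((a + L) / a) := by
    have h1 : (a + L) / a = 1 + Real.exp K := by
      rw [ha]; field_simp
    rw [h1]
    have h2 : Real.exp K < 1 + Real.exp K := by linarith
    calc K = Real.log (Real.exp K) := (Real.log_exp K).symm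
      _ < Real.log (1 + Real.exp K) := Real.log_lt_log (Real.exp_pos K) h2
  have hfrac : L / (a + L) ≤ 1 := by
    rw [div_le_one (by positivity)]; linarith
  have : M = 2 * π * κ ^ 2 * (K - 1) := by rw [hK]; field_simp; ring
  rw [this]
  exact mul_lt_mul_of_pos_left (by linarith) hc

/-- **What the crux excludes: scarred blow-up.** GIVEN `PlanarEnergyAPriori`, no classical
solution of unforced Navier–Stokes on `[0,T)` that is Leray–Hopf from a rapidly decaying datum can
carry, before `T`, scar lower bounds `‖u(t,x)‖ ≥ κ/(a + ‖x − x₀‖)` on a fixed ball `B(x₀, L)` with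
arbitrarily small cores `a > 0` (`κ, L > 0`): the planar energy through `x₀` would exceed every
bound (`planarEnergy_ge_of_scar`, `exists_scar_lowerBound_gt`). In particular the crux rules out
every (discretely) self-similar Type-I blow-up whose profile has the non-degenerate `|x|⁻¹` far
field (route file KILL CRITERIA / NUMBERS). [folklore] -/
theorem PlanarEnergyAPriori.no_scar
    (h : Summit.NavierStokesRegularity.NavierStokesRegularity.Theses.PlaneEnergyCeiling.PlanarEnergyAPriori)
    {ν T : ℝ} (hν : 0 < ν) (hT : 0 < T)
    {u : ℝ → EuclideanSpace ℝ (Fin 3) → EuclideanSpace ℝ (Fin 3)} {p : ℝ → EuclideanSpace ℝ (Fin 3) → ℝ}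
    (hcl : Literature.Analysis.FluidPDE.IsClassicalNSSolutionOn (Set.Ico 0 T) ν 0 u p)
    (hLH : Literature.Analysis.FluidPDE.IsLerayHopfOn T ν 0 (u 0) u)
    (hdec : Literature.Analysis.FluidPDE.HasRapidSpatialDecay (u 0))
    (x₀ : EuclideanSpace ℝ (Fin 3)) {κ L : ℝ} (hκ : 0 < κ) (hL : 0 < L) :
    ¬ ∀ a > 0, ∃ t ∈ Set.Ico 0 T, ∀ x ∈ ball x₀ L, κ / (a + ‖x - x₀‖) ≤ ‖u t x‖ := by
  intro hscar
  obtain ⟨M, hM⟩ := h ν T hν hT u p hcl hLH hdec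
  obtain ⟨a, ha, hgt⟩ := exists_scar_lowerBound_gt hκ hL (max M 0)
  obtain ⟨t, ht, hsc⟩ := hscar a ha
  have hlow := planarEnergy_ge_of_scar hκ.le ha hL.le x₀ hsc
  have hup := hM t ht (LinearIsometryEquiv.refl ℝ _) (x₀ 2)
  simp only [LinearIsometryEquiv.coe_refl, id_eq] at hup
  have hlt : ENNReal.ofReal M < ENNReal.ofReal (2 * π * κ ^ 2 * (Real.log ((a + L) / a) - L / (a + L))) :=
    (ENNReal.ofReal_lt_ofReal_iff ((le_max_right M 0).trans_lt hgt)).2 ((le_max_left M 0).trans_lt hgt)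
  exact (lt_irrefl _) ((hlt.trans_le hlow).trans_le hup)

/-- **What the crux gives for free: the Type-I-in-energy class.** GIVEN `PlanarEnergyAPriori`,
every classical solution of unforced Navier–Stokes on `[0,T)` that is Leray–Hopf from a rapidly
decaying datum has uniformly bounded Caffarelli–Kohn–Nirenberg scaled energy:
`∫_{B_r(x₀)} |u(t)|² ≤ 2 r M` for all `t < T`, all centres `x₀` and radii `r > 0` (one `M ≥ 0`) —
the planar ceiling fed into the support item `ScaledEnergyOfPlanar`. So under the crux any
singularity is Type I in Seregin's scaled-energy sense (strategist census D1, piece 1). [folklore] -/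
theorem PlanarEnergyAPriori.scaledEnergy_bound
    (h : Summit.NavierStokesRegularity.NavierStokesRegularity.Theses.PlaneEnergyCeiling.PlanarEnergyAPriori)
    {ν T : ℝ} (hν : 0 < ν) (hT : 0 < T)
    {u : ℝ → EuclideanSpace ℝ (Fin 3) → EuclideanSpace ℝ (Fin 3)} {p : ℝ → EuclideanSpace ℝ (Fin 3) → ℝ}
    (hcl : Literature.Analysis.FluidPDE.IsClassicalNSSolutionOn (Set.Ico 0 T) ν 0 u p)
    (hLH : Literature.Analysis.FluidPDE.IsLerayHopfOn T ν 0 (u 0) u)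
    (hdec : Literature.Analysis.FluidPDE.HasRapidSpatialDecay (u 0)) :
    ∃ M : ℝ, 0 ≤ M ∧ ∀ t ∈ Set.Ico 0 T, ∀ (x₀ : EuclideanSpace ℝ (Fin 3)) (r : ℝ), 0 < r →
      ∫⁻ x in ball x₀ r, ‖u t x‖ₑ ^ 2 ≤ ENNReal.ofReal (2 * r * M) := by
  obtain ⟨M, hM⟩ := h ν T hν hT u p hcl hLH hdec
  refine ⟨max M 0, le_max_right _ _, fun t ht x₀ r hr => ?_⟩
  have hcont : Continuous (u t) := (hcl.contDiff_velocity ht).continuous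
  refine planeEnergyCeiling_scaledEnergyOfPlanar (u t) hcont (max M 0) (le_max_right _ _)
    (fun R c => (hM t ht R c).trans (ENNReal.ofReal_le_ofReal (le_max_left _ _))) x₀ r hr

/-- **`planarEnergyAPriori_no_scar`, registered form** (sub-goal of stmt-NavierStokesRegularity-16855;
calibration of the crux): for every classical Leray–Hopf solution from a rapidly decaying datum on
`[0,T)`, the crux `PlanarEnergyAPriori` forbids scar lower bounds `‖u(t,x)‖ ≥ κ/(a + ‖x − x₀‖)`
on a fixed ball `B(x₀,L)` with arbitrarily small cores `a > 0` before `T` — the `|x|⁻¹` far field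
of a (discretely) self-similar Type-I blow-up makes the planar energy through `x₀` log-divergent.
[folklore] -/
theorem planarEnergyAPriori_no_scar : ∀ (ν T : ℝ), 0 < ν → 0 < T → ∀ (u : ℝ → EuclideanSpace ℝ (Fin 3) → EuclideanSpace ℝ (Fin 3)) (p : ℝ → EuclideanSpace ℝ (Fin 3) → ℝ), Literature.Analysis.FluidPDE.IsClassicalNSSolutionOn (Set.Ico 0 T) ν 0 u p → Literature.Analysis.FluidPDE.IsLerayHopfOn T ν 0 (u 0) u → Literature.Analysis.FluidPDE.HasRapidSpatialDecay (u 0) → Summit.NavierStokesRegularity.NavierStokesRegularity.Theses.PlaneEnergyCeiling.PlanarEnergyAPriori → ∀ (x₀ : EuclideanSpace ℝ (Fin 3)) (κ L : ℝ), 0 < κ → 0 < L → ¬ ∀ a > 0, ∃ t ∈ Set.Ico 0 T, ∀ x ∈ Metric.ball x₀ L, κ / (a + ‖x - x₀‖) ≤ ‖u t x‖ :=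
  fun _ _ hν hT _ _ hcl hLH hdec h x₀ _ _ hκ hL => PlanarEnergyAPriori.no_scar h hν hT hcl hLH hdec x₀ hκ hL

end Summit.NavierStokesRegularity.NavierStokesRegularity.Theorems.PlanarEnergyAPriori

end
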